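import Summits.PneNP.PneNP.Theorems.ChebyshevTracialDesignExtendedSign
import HarnessLib

/-!
# Cell pnp-psdrank, route `ChebyshevTracialDesign`: THE TWO-CUTOFF BOUND — the design value of a contraction pair whose AVERAGED LEVEL LAW is an
# exact polynomial of degree `K ≤ c'` with nonnegative virtual value is `≤ r·(B_v√P_D + 2^{K+1}√P_K + Σ_{κ∈(D/2,K/2]} R_κ√A_κ)`
# (bricks 89/90 made abstract; crux `TracialDecayExp20`, stmt-PneNP-19878)

Brick 94a (prover g18; MEMO-20 §2(c)/§4(1), MEMO-21 §1). Bricks 89 (`…ExtrapolatedSign`), 90 (`…ExtendedSign`), 90b (`…ExtendedSignDirectional`) and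
93 (`…ExtendedSignMatchingSide`) each re-prove the same two-cutoff argument around a different source of the exact level law (Grigoriev per
matching for a Gram cut factor, per direction for compressions, per cut for a Gram matching factor). This file states the argument ONCE, with the
level law as a hypothesis:
* **`value_le_of_avgLevelLaw_allModes`** — for `n` even, an exact design `(n, t = 2c'+1, T, D ≤ 2c', B_v, C, w)`, contraction fields `X`, `Y`, a
  cutoff `D ≤ K ≤ c'`, and ANY real polynomial `Ps` of degree `≤ K` with `Ps(0) ≥ 0` that is the exact averaged level law of the pair
  (`Σ_{Q_c(t)} tr(X_U Y_M) = |Q_c(t)|·Ps(c)` at every odd level `c ≤ t`):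
  `Σ W·tr(X_U Y_M) ≤ r·(B_v√P_D + 2^{K+1}√P_K + Σ_{κ∈(D/2, K/2]} R_κ√A_κ)` — brick 20 at cutoff `K` (`…TracialProfilePolynomial`), extrapolation
  stability at the `K+1` odd nodes `1,…,2K+1` (brick 89 §1 `abs_eval_zero_le_two_pow_mul`: `VV_K/|PM| ≥ −2^{K+1} r√P_K`), bricks 45b/45d across
  the bi-modes `(D/2, K/2]` (`virtual_psd_mul_eq`, `HSmode_sq_le_traces`), brick 22a at `D` (`tracial_value_truncation_of_data`).
* **`value_le_of_avgLevelLaw_above_design`** — the brick-89 form: `≤ (2^{K+1} + B_v)·r√P_D` (extrapolate the degree-`D` tail directly; no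
  harmonic crossing; useful while `2^K√P_D ≪ e^{−aD}`).
* `card_Qset_pos` — the level classes are nonempty at every odd level (bookkeeping).
Consumers: brick 94b (`…ExtendedSignSharp`: the SIGN cell at all Gram degrees `k ≤ c'` via the half-degree law `lowdeg_sum_law_sharp`, plain and
directional). Where the law comes from is no longer this theorem's business; only its DEGREE enters, through the number of real odd nodes.
[cite: Grigoriev2001, Lemma 1.4 (PDF p. 8)] [cite: Rothvoss2017, §2 (PDF p. 6)] [cite: GriblingDelaatLaurent2019, §5]
[cite: BrouwerHaemers2012, Thm. 4.9.1 (PDF p. 93)] [cite: CoppersmithRivlin1992, Thm. (p. 970)]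
Stature: support/instrument (kernel lane, no defs, axioms standard). WHAT THIS IS NOT: no new cell, no proof or refutation of `TracialDecayExp20`,
nothing on psd rank of P_PM(K_n), no P-vs-NP content. Supports stmt-PneNP-19878.
-/

set_option linter.dupNamespace false -- `Summit.PneNP.PneNP.…`: summit = sub-problem (D-0017)

noncomputable section

namespace Summit.PneNP.PneNP.Theorems.ChebyshevTracialDesignTwoCutoffBound

open Finset Matrix Polynomial Literature.Barriers.PneNP Literature.Combinatorics.SimpleGraph.CycleSpace
open Literature.Computability.Complexity Literature.Combinatorics.Optimization
open Literature.Combinatorics.AssociationSchemes Literature.Combinatorics.AssociationSchemes.JohnsonHarmonics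
open Literature.Combinatorics.AssociationSchemes.JohnsonSpectrum
open Summit.PneNP.PneNP.Theorems.ChebyshevTracialDesignJunta
open Summit.PneNP.PneNP.Theorems.ChebyshevTracialDesignTracialProfilePolynomial
open Summit.PneNP.PneNP.Theorems.ChebyshevTracialDesignProfileExtrapolation (value_eq_level_sums)
open Summit.PneNP.PneNP.Theorems.ChebyshevTracialDesignProfilePolynomial (card_pmatch_pos)
open Summit.PneNP.PneNP.Theorems.ChebyshevTracialDesignLevelNormalisation (card_Qset_eq)
open Summit.PneNP.PneNP.Theorems.ChebyshevTracialDesignExtrapolatedSign (abs_eval_zero_le_two_pow_mul)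
open Summit.PneNP.PneNP.Theorems.ChebyshevTracialDesignExtendedSign (sum_trace_cuts_le sum_trace_matchings_le)
open Summit.PneNP.PneNP.Theorems.ChebyshevTracialDesignVirtualBimodePsd (virtual_psd_mul_eq)
open Summit.PneNP.PneNP.Theorems.ChebyshevTracialDesignHSModeParseval (HSmode_sq_le_traces)
open Summit.PneNP.PneNP.Theorems.ChebyshevTracialDesignVirtualValueUnique (tracial_value_truncation_of_data)
open Summit.PneNP.PneNP.Theorems.ChebyshevTracialDesignWhiteningData (layerRatio_nonneg)
open Summit.PneNP.PneNP.Theorems.ChebyshevTracialDesignTightFreeSpectral (exists_tightGram_classFunction)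
open scoped MatrixOrder

variable {n : ℕ}

/-! ### §1 The abstract two-cutoff bound from an averaged exact level law -/

/-- The level classes `Q_c(t)`, `t = 2c'+1 < n/2`, are nonempty at every odd level `c = 2m+1 ≤ t`: `0 < |Q_c(t)|`. [cite: Rothvoss2017, §2 (PDF p. 6)] -/
theorem card_Qset_pos {c' m : ℕ} (hn : Even n) (ht : 2 * (2 * c' + 1) ≤ n) (hmc : m ≤ c') :
    (0 : ℝ) < ((Qset n (2 * c' + 1) (2 * m + 1)).card : ℝ) := by
  rw [card_Qset_eq hmc]
  have hPm : (0 : ℝ) < Fintype.card (PMatch n) := by exact_mod_cast card_pmatch_pos hn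
  have h1 : 0 < (n / 2).choose (2 * m + 1 + (c' - m)) := Nat.choose_pos (by omega)
  have h2 : 0 < (2 * m + 1 + (c' - m)).choose (c' - m) := Nat.choose_pos (by omega)
  have h3 : (0 : ℝ) < (((n / 2).choose (2 * m + 1 + (c' - m)) * (2 * m + 1 + (c' - m)).choose (c' - m) * 2 ^ (2 * m + 1) : ℕ) : ℝ) := by
    exact_mod_cast Nat.mul_pos (Nat.mul_pos h1 h2) (pow_pos (by norm_num) _)
  exact mul_pos hPm h3

/-- **THE ABSTRACT TWO-CUTOFF BOUND.** For `n` even, an exact design `(n, t = 2c'+1, T, D, B_v, C, w)` with `D ≤ 2c'`, contraction fields `X` (odd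
cuts) and `Y` (perfect matchings), a cutoff `K` with `D ≤ K ≤ c'`, and a polynomial `Ps` of degree `≤ K` with `Ps(0) ≥ 0` which is the exact
averaged level law of the pair — `Σ_{(U,M) ∈ Q_c(t)} tr(X_U Y_M) = |Q_c(t)|·Ps(c)` at every odd level `c ≤ t` — one has
`Σ_{U,M} levelWeight(U,M)·tr(X_U Y_M) ≤ r·(B_v·√P_D + 2^{K+1}·√P_K + Σ_{κ ∈ (D/2, K/2]} R_κ·√A_κ)`,
`P_K = Π_{i≤K/2}(2i+1)/(n−2i)`, `A_κ = Π_{i<κ}(2i+1)/(n−2i)`, `R_κ = Π_{i<κ}(t−2i)(n−t−2i)/((t−1−2i)(n−t−1−2i))`.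
MECHANISM: brick 20's profile polynomial `P_K` at cutoff `K` is `r√P_K`-close to `Ps` at all `c'+1 ≥ K+1` odd nodes, so `VV_K/|PM| = P_K(0) ≥
−2^{K+1} r√P_K` (brick 89 §1); bricks 45b/45d cross the bi-modes `(D/2, K/2]`; brick 22a prices `−VV_D/|PM|` up to `B_v r√P_D`.
[cite: Grigoriev2001, Lemma 1.4 (PDF p. 8)] [cite: Rothvoss2017, §2 (PDF p. 6)] [cite: GriblingDelaatLaurent2019, §5]
[cite: BrouwerHaemers2012, Thm. 4.9.1 (PDF p. 93)] [cite: CoppersmithRivlin1992, Thm. (p. 970)] -/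
theorem value_le_of_avgLevelLaw_allModes {c' T D : ℕ} {Bv : ℝ} {C : Finset ℕ} {w : ℕ → ℝ} (hn : Even n)
    (hdes : IsExactDesign n (2 * c' + 1) T D Bv C w) (hD : D ≤ 2 * c') {r K : ℕ} (hDK : D ≤ K) (hKc : K ≤ c')
    (X : OddSet n → Matrix (Fin r) (Fin r) ℝ) (hX : ∀ U, (X U).PosSemidef ∧ (1 - X U).PosSemidef)
    (Y : PMatch n → Matrix (Fin r) (Fin r) ℝ) (hY : ∀ M, (Y M).PosSemidef ∧ (1 - Y M).PosSemidef)
    (Ps : Polynomial ℝ) (hPsdeg : Ps.natDegree ≤ K) (hPs0 : 0 ≤ Ps.eval 0)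
    (hlaw : ∀ mm : ℕ, mm ≤ c' → ∑ q ∈ Qset n (2 * c' + 1) (2 * mm + 1), (X q.1 * Y q.2).trace =
      ((Qset n (2 * c' + 1) (2 * mm + 1)).card : ℝ) * Ps.eval ((2 * mm + 1 : ℕ) : ℝ)) :
    ∑ U, ∑ M, levelWeight n (2 * c' + 1) C w U M * (X U * Y M).trace ≤
      (r : ℝ) * (Bv * Real.sqrt (∏ i ∈ range (D / 2 + 1), ((2 * i + 1 : ℝ) / ((n : ℝ) - 2 * i))) +
        2 ^ (K + 1) * Real.sqrt (∏ i ∈ range (K / 2 + 1), ((2 * i + 1 : ℝ) / ((n : ℝ) - 2 * i))) +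
        ∑ κ ∈ Ico (D / 2 + 1) (K / 2 + 1),
          (∏ i ∈ range κ, (((2 * c' + 1 : ℝ) - 2 * i) * ((n : ℝ) - 2 * c' - 1 - 2 * i) /
              (((2 * c' : ℝ) - 2 * i) * ((n : ℝ) - 2 * c' - 2 - 2 * i)))) *
            Real.sqrt (∏ i ∈ range κ, ((2 * i + 1 : ℝ) / ((n : ℝ) - 2 * i)))) := by
  classical
  have hdes' := hdes
  obtain ⟨htodd, htn, hTt, hC, -, hexact, hBv⟩ := hdes
  have ht : 2 * (2 * c' + 1) ≤ n := by omega
  -- constants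
  have hPm : (0 : ℝ) < Fintype.card (PMatch n) := by exact_mod_cast card_pmatch_pos hn
  have hCn : (0 : ℝ) < (n.choose (2 * c' + 1) : ℝ) := by exact_mod_cast Nat.choose_pos (by omega)
  set Pm : ℝ := (Fintype.card (PMatch n) : ℝ) with hPmdef
  set Cn : ℝ := (n.choose (2 * c' + 1) : ℝ) with hCndef
  set N₁ : ℝ := ((((n / 2).choose (1 + c') * (1 + c').choose c' * 2 ^ 1 : ℕ) : ℝ)) with hN₁
  have hN₁pos : 0 < N₁ := by
    rw [hN₁]
    have h1 : 0 < (n / 2).choose (1 + c') := Nat.choose_pos (by omega)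
    have h2 : 0 < (1 + c').choose c' := Nat.choose_pos (by omega)
    exact_mod_cast Nat.mul_pos (Nat.mul_pos h1 h2) (by norm_num)
  set Aκ : ℕ → ℝ := fun κ => ∏ i ∈ range κ, ((2 * i + 1 : ℝ) / ((n : ℝ) - 2 * i)) with hAκ
  set R : ℕ → ℝ := fun κ => ∏ i ∈ range κ, (((2 * c' + 1 : ℝ) - 2 * i) * ((n : ℝ) - 2 * c' - 1 - 2 * i) /
    (((2 * c' : ℝ) - 2 * i) * ((n : ℝ) - 2 * c' - 2 - 2 * i))) with hR
  have hAκ0 : ∀ κ, κ ≤ c' → 0 ≤ Aκ κ := fun κ hκ => by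
    rw [hAκ]
    refine prod_nonneg fun i hi => ?_
    have hi' := mem_range.1 hi
    have : (2 * i : ℝ) + 2 ≤ n := by exact_mod_cast (show 2 * i + 2 ≤ n by omega)
    exact div_nonneg (by positivity) (by linarith)
  -- Step 1: brick 20 at the cutoff `K`: harmonic data `p` and the degree-`K` profile polynomial `PK` with `PK(0) = VV_K(p)/|PM|`
  obtain ⟨p, PK, hp, hpdec, hPKdeg, hPK0, hlevK⟩ :=
    tracial_profile_polynomial_of_contractions hn htn (show K ≤ 2 * c' by omega) X Y hX hY
  set τK : ℝ := (r : ℝ) * Real.sqrt (∏ i ∈ range (K / 2 + 1), ((2 * i + 1 : ℝ) / ((n : ℝ) - 2 * i))) with hτK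
  have hτK0 : 0 ≤ τK := mul_nonneg (Nat.cast_nonneg r) (Real.sqrt_nonneg _)
  have hcloseK : ∀ mm : ℕ, mm ≤ c' → |Ps.eval ((2 * mm + 1 : ℕ) : ℝ) - PK.eval ((2 * mm + 1 : ℕ) : ℝ)| ≤ τK := by
    intro mm hmm
    have hQpos := card_Qset_pos hn ht hmm
    have h1 := hlevK mm hmm
    rw [hlaw mm hmm, ← mul_sub, abs_mul, Nat.abs_cast] at h1
    exact le_of_mul_le_mul_left h1 hQpos
  -- virtual nonnegativity at the cutoff `K`, up to the extrapolated tail: `PK(0) ≥ −2^{K+1} τK`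
  have hPK0_lb : -(2 ^ (K + 1) * τK) ≤ PK.eval 0 := by
    set Δ : Polynomial ℝ := Ps - PK with hΔ
    have hΔdeg : Δ.natDegree ≤ K := (natDegree_sub_le _ _).trans (max_le hPsdeg hPKdeg)
    have hΔ0 : |Δ.eval 0| ≤ 2 ^ (K + 1) * τK := by
      refine abs_eval_zero_le_two_pow_mul K Δ hΔdeg hτK0 fun j hj => ?_
      have h := hcloseK j (by omega)
      rw [hΔ, eval_sub]
      push_cast at h ⊢
      exact h
    have h1 := (abs_le.1 hΔ0).2
    rw [hΔ, eval_sub] at h1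
    linarith
  -- Step 2: the virtual values at the two cutoffs, in bi-mode form (brick 45b)
  set k₁ : Finset (Fin n) → PMatch n → ℝ := fun U M => if (U.filter fun x => M.2.partner x ∉ U).card = 1 then (1 : ℝ) else 0 with hk₁
  set Cm : ℕ → ℝ := fun κ => ∑ ab : Fin r × Fin r, ∑ M : PMatch n, Y M ab.2 ab.1 * ∑ U ∈ univ.powersetCard (2 * c' + 1),
    (up^[2 * c' + 1 - 2 * κ] (p ab (2 * κ))) U * k₁ U M with hCm
  set VK : ℝ := ∑ M : PMatch n, ∑ A' : {A' : Finset (Fin n) // A'.card ≤ K},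
        (Matrix.of (fun a b : Fin r =>
          (∑ j ∈ range (2 * c' + 1 + 1), ((2 * c' + 1 - j).factorial : ℝ) • (if K < j then 0 else p (a, b) j)) A'.1) * Y M).trace *
          knapsackMoment M.1.card (((2 * c' + 1 : ℕ) : ℝ) / 2) (M.1.filter fun e => ∃ a ∈ A'.1, a ∈ e).card with hVK
  set VD : ℝ := ∑ M : PMatch n, ∑ A' : {A' : Finset (Fin n) // A'.card ≤ D},
        (Matrix.of (fun a b : Fin r =>
          (∑ j ∈ range (2 * c' + 1 + 1), ((2 * c' + 1 - j).factorial : ℝ) • (if D < j then 0 else p (a, b) j)) A'.1) * Y M).trace *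
          knapsackMoment M.1.card (((2 * c' + 1 : ℕ) : ℝ) / 2) (M.1.filter fun e => ∃ a ∈ A'.1, a ∈ e).card with hVD
  have h45K : VK * N₁ = ∑ κ ∈ range (K / 2 + 1), R κ * Cm κ := virtual_psd_mul_eq hn ht (show K ≤ 2 * c' by omega) p hp Y
  have h45D : VD * N₁ = ∑ κ ∈ range (D / 2 + 1), R κ * Cm κ := virtual_psd_mul_eq hn ht hD p hp Y
  -- `VK = Pm · PK(0)`
  have hVK_eq : VK = Pm * PK.eval 0 := by
    rw [hPK0, ← mul_assoc, mul_inv_cancel₀ hPm.ne', one_mul]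
  -- Step 3: the modes between the two cutoffs (brick 45d)
  obtain ⟨κ₁, hA1⟩ := exists_tightGram_classFunction (n := n) (odd_two_mul_add_one c')
  have hXtr := sum_trace_cuts_le (c' := c') hX
  have hYtr := sum_trace_matchings_le hY
  have hmode : ∀ κ, κ ≤ c' → |Cm κ| ≤ (r : ℝ) * Pm * N₁ * Real.sqrt (Aκ κ) := by
    intro κ hκ
    have hsq := HSmode_sq_le_traces hn ht hκ X Y hX hY p hp hpdec κ₁ hA1
    have hbound : (∑ M : PMatch n, (Y M).trace) * (∑ U ∈ univ.filter (fun U : OddSet n => U.1.card = 2 * c' + 1), (X U).trace) *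
        (Pm * N₁ ^ 2 / Cn * Aκ κ) ≤ ((r : ℝ) * Pm * N₁ * Real.sqrt (Aκ κ)) ^ 2 := by
      have hYtr0 : 0 ≤ ∑ M : PMatch n, (Y M).trace := sum_nonneg fun M _ => (hY M).1.trace_nonneg
      have hXtr0 : 0 ≤ ∑ U ∈ univ.filter (fun U : OddSet n => U.1.card = 2 * c' + 1), (X U).trace :=
        sum_nonneg fun U _ => (hX U).1.trace_nonneg
      have hc0 : 0 ≤ Pm * N₁ ^ 2 / Cn * Aκ κ := mul_nonneg (div_nonneg (mul_nonneg hPm.le (sq_nonneg _)) hCn.le) (hAκ0 κ hκ)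
      calc (∑ M : PMatch n, (Y M).trace) * (∑ U ∈ univ.filter (fun U : OddSet n => U.1.card = 2 * c' + 1), (X U).trace) *
            (Pm * N₁ ^ 2 / Cn * Aκ κ)
          ≤ ((r : ℝ) * Pm) * ((r : ℝ) * Cn) * (Pm * N₁ ^ 2 / Cn * Aκ κ) := by
            exact mul_le_mul_of_nonneg_right (mul_le_mul hYtr hXtr hXtr0 (mul_nonneg (Nat.cast_nonneg r) hPm.le)) hc0
        _ = (r : ℝ) ^ 2 * Pm ^ 2 * N₁ ^ 2 * Aκ κ * (Cn * Cn⁻¹) := by ring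
        _ = (r : ℝ) ^ 2 * Pm ^ 2 * N₁ ^ 2 * Aκ κ := by rw [mul_inv_cancel₀ hCn.ne', mul_one]
        _ = ((r : ℝ) * Pm * N₁ * Real.sqrt (Aκ κ)) ^ 2 := by
            rw [show ((r : ℝ) * Pm * N₁ * Real.sqrt (Aκ κ)) ^ 2 = (r : ℝ) ^ 2 * Pm ^ 2 * N₁ ^ 2 * (Real.sqrt (Aκ κ)) ^ 2 by ring,
              Real.sq_sqrt (hAκ0 κ hκ)]
    have h2 : (Cm κ) ^ 2 ≤ ((r : ℝ) * Pm * N₁ * Real.sqrt (Aκ κ)) ^ 2 := hsq.trans hbound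
    have h3 : 0 ≤ (r : ℝ) * Pm * N₁ * Real.sqrt (Aκ κ) :=
      mul_nonneg (mul_nonneg (mul_nonneg (Nat.cast_nonneg r) hPm.le) hN₁pos.le) (Real.sqrt_nonneg _)
    exact abs_le.2 (abs_le_of_sq_le_sq' h2 h3)
  have hmid : |∑ κ ∈ Ico (D / 2 + 1) (K / 2 + 1), R κ * Cm κ| ≤
      (r : ℝ) * Pm * N₁ * ∑ κ ∈ Ico (D / 2 + 1) (K / 2 + 1), R κ * Real.sqrt (Aκ κ) := by
    calc |∑ κ ∈ Ico (D / 2 + 1) (K / 2 + 1), R κ * Cm κ| ≤ ∑ κ ∈ Ico (D / 2 + 1) (K / 2 + 1), |R κ * Cm κ| := abs_sum_le_sum_abs _ _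
      _ ≤ ∑ κ ∈ Ico (D / 2 + 1) (K / 2 + 1), R κ * ((r : ℝ) * Pm * N₁ * Real.sqrt (Aκ κ)) := by
          refine sum_le_sum fun κ hκ => ?_
          have hκc : κ ≤ c' := by have := (mem_Ico.1 hκ).2; omega
          rw [abs_mul, abs_of_nonneg (layerRatio_nonneg ht hκc)]
          exact mul_le_mul_of_nonneg_left (hmode κ hκc) (layerRatio_nonneg ht hκc)
      _ = (r : ℝ) * Pm * N₁ * ∑ κ ∈ Ico (D / 2 + 1) (K / 2 + 1), R κ * Real.sqrt (Aκ κ) := by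
          rw [mul_sum]; exact sum_congr rfl fun κ _ => by ring
  -- `VD·N₁ = VK·N₁ − (middle modes)`
  have hsplit : VD * N₁ = VK * N₁ - ∑ κ ∈ Ico (D / 2 + 1) (K / 2 + 1), R κ * Cm κ := by
    rw [h45D, h45K, ← sum_range_add_sum_Ico _ (show D / 2 + 1 ≤ K / 2 + 1 by omega)]
    ring
  -- hence a lower bound on `VD / Pm`
  have hVD_lb : -(2 ^ (K + 1) * τK) - (r : ℝ) * ∑ κ ∈ Ico (D / 2 + 1) (K / 2 + 1), R κ * Real.sqrt (Aκ κ) ≤ Pm⁻¹ * VD := by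
    have h1 : Pm * N₁ * (-(2 ^ (K + 1) * τK)) ≤ VK * N₁ := by
      rw [hVK_eq]
      have := mul_le_mul_of_nonneg_left hPK0_lb (mul_pos hPm hN₁pos).le
      linarith [this]
    have h2 := (abs_le.1 hmid).2
    have h3 : Pm * N₁ * (-(2 ^ (K + 1) * τK) - (r : ℝ) * ∑ κ ∈ Ico (D / 2 + 1) (K / 2 + 1), R κ * Real.sqrt (Aκ κ)) ≤ VD * N₁ := by
      rw [hsplit]; nlinarith [h1, h2]
    have h4 : (-(2 ^ (K + 1) * τK) - (r : ℝ) * ∑ κ ∈ Ico (D / 2 + 1) (K / 2 + 1), R κ * Real.sqrt (Aκ κ)) * (Pm * N₁) ≤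
        (Pm⁻¹ * VD) * (Pm * N₁) := by
      calc _ = Pm * N₁ * (-(2 ^ (K + 1) * τK) - (r : ℝ) * ∑ κ ∈ Ico (D / 2 + 1) (K / 2 + 1), R κ * Real.sqrt (Aκ κ)) := by ring
        _ ≤ VD * N₁ := h3
        _ = (Pm⁻¹ * VD) * (Pm * N₁) := by field_simp
    exact le_of_mul_le_mul_right h4 (mul_pos hPm hN₁pos)
  -- Step 4: the design value is `−VD/Pm` up to the degree-D tail (brick 20 / 22a for the datum `p`)
  have htrunc := tracial_value_truncation_of_data hn hdes' hD X Y p hp hpdec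
  have hPD := Summit.PneNP.PneNP.Theorems.ChebyshevTracialDesignProfilePolynomial.prod_atten_nonneg (n := n) (K := D) (by omega)
  have htail := sqrt_tail_le_of_le hPD hCn hPm (Nat.cast_nonneg r)
    (sum_nonneg fun M _ => by positivity) (sum_frobenius_cuts_le ⟨c', rfl⟩ hX) (sum_frobenius_matchings_le hY)
  have hBv0 : 0 ≤ ∑ c ∈ C, |w c| := sum_nonneg fun c _ => abs_nonneg _
  have hval_le : ∑ U, ∑ M, levelWeight n (2 * c' + 1) C w U M * (X U * Y M).trace ≤
      -(Pm⁻¹ * VD) + Bv * ((r : ℝ) * Real.sqrt (∏ i ∈ range (D / 2 + 1), ((2 * i + 1 : ℝ) / ((n : ℝ) - 2 * i)))) := by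
    have h1 := (abs_le.1 htrunc).2
    have h2 : (∑ c ∈ C, |w c|) * Real.sqrt ((∏ i ∈ range (D / 2 + 1), ((2 * i + 1 : ℝ) / ((n : ℝ) - 2 * i))) *
        ((∑ U : OddSet n, if U.1.card = 2 * c' + 1 then ∑ a, ∑ b, X U a b ^ 2 else 0) / (n.choose (2 * c' + 1) : ℝ)) *
        ((∑ M : PMatch n, ∑ a, ∑ b, Y M a b ^ 2) / (Fintype.card (PMatch n) : ℝ))) ≤
        Bv * ((r : ℝ) * Real.sqrt (∏ i ∈ range (D / 2 + 1), ((2 * i + 1 : ℝ) / ((n : ℝ) - 2 * i)))) :=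
      (mul_le_mul_of_nonneg_left htail hBv0).trans (mul_le_mul_of_nonneg_right hBv (mul_nonneg (Nat.cast_nonneg r) (Real.sqrt_nonneg _)))
    linarith
  -- assemble
  have e : (r : ℝ) * (Bv * Real.sqrt (∏ i ∈ range (D / 2 + 1), ((2 * i + 1 : ℝ) / ((n : ℝ) - 2 * i))) +
      2 ^ (K + 1) * Real.sqrt (∏ i ∈ range (K / 2 + 1), ((2 * i + 1 : ℝ) / ((n : ℝ) - 2 * i))) +
      ∑ κ ∈ Ico (D / 2 + 1) (K / 2 + 1), R κ * Real.sqrt (Aκ κ)) =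
      Bv * ((r : ℝ) * Real.sqrt (∏ i ∈ range (D / 2 + 1), ((2 * i + 1 : ℝ) / ((n : ℝ) - 2 * i)))) +
      2 ^ (K + 1) * τK + (r : ℝ) * ∑ κ ∈ Ico (D / 2 + 1) (K / 2 + 1), R κ * Real.sqrt (Aκ κ) := by
    rw [hτK]; ring
  rw [e]
  linarith [hval_le, hVD_lb]

/-- **THE BRICK-89 FORM.** Same data with `D ≤ K ≤ c'` (no `D ≤ 2c'` needed separately): brick 20's degree-`D` profile polynomial is `r√P_D`-close
to `Ps` at the odd nodes, the difference (degree `≤ K`) extrapolates to `0` at cost `2^{K+1}`, and exactness prices the profile polynomial: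
`Σ W·tr(X_U Y_M) ≤ (2^{K+1} + B_v)·r·√P_D`. [cite: Grigoriev2001, Lemma 1.4 (PDF p. 8)] [cite: Rothvoss2017, §2 (PDF p. 6)]
[cite: CoppersmithRivlin1992, Thm. (p. 970)] -/
theorem value_le_of_avgLevelLaw_above_design {c' T D : ℕ} {Bv : ℝ} {C : Finset ℕ} {w : ℕ → ℝ} (hn : Even n)
    (hdes : IsExactDesign n (2 * c' + 1) T D Bv C w) {r K : ℕ} (hDK : D ≤ K) (hKc : K ≤ c')
    (X : OddSet n → Matrix (Fin r) (Fin r) ℝ) (hX : ∀ U, (X U).PosSemidef ∧ (1 - X U).PosSemidef)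
    (Y : PMatch n → Matrix (Fin r) (Fin r) ℝ) (hY : ∀ M, (Y M).PosSemidef ∧ (1 - Y M).PosSemidef)
    (Ps : Polynomial ℝ) (hPsdeg : Ps.natDegree ≤ K) (hPs0 : 0 ≤ Ps.eval 0)
    (hlaw : ∀ mm : ℕ, mm ≤ c' → ∑ q ∈ Qset n (2 * c' + 1) (2 * mm + 1), (X q.1 * Y q.2).trace =
      ((Qset n (2 * c' + 1) (2 * mm + 1)).card : ℝ) * Ps.eval ((2 * mm + 1 : ℕ) : ℝ)) :
    ∑ U, ∑ M, levelWeight n (2 * c' + 1) C w U M * (X U * Y M).trace ≤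
      (2 ^ (K + 1) + Bv) * ((r : ℝ) * Real.sqrt (∏ i ∈ range (D / 2 + 1), ((2 * i + 1 : ℝ) / ((n : ℝ) - 2 * i)))) := by
  classical
  obtain ⟨htodd, htn, hTt, hC, -, hexact, hBv⟩ := hdes
  have ht : 2 * (2 * c' + 1) ≤ n := by omega
  -- brick 20's degree-D profile polynomial, `r√P_D`-close at every odd level
  obtain ⟨p, PD, -, -, hPDdeg, -, hlev⟩ :=
    tracial_profile_polynomial_of_contractions hn htn (by omega : D ≤ 2 * c') X Y hX hY
  set τ : ℝ := (r : ℝ) * Real.sqrt (∏ i ∈ range (D / 2 + 1), ((2 * i + 1 : ℝ) / ((n : ℝ) - 2 * i))) with hτ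
  have hτ0 : 0 ≤ τ := by positivity
  have hclose : ∀ mm : ℕ, mm ≤ c' → |Ps.eval ((2 * mm + 1 : ℕ) : ℝ) - PD.eval ((2 * mm + 1 : ℕ) : ℝ)| ≤ τ := by
    intro mm hmm
    have hQpos := card_Qset_pos hn ht hmm
    have h1 := hlev mm hmm
    rw [hlaw mm hmm, ← mul_sub, abs_mul, Nat.abs_cast] at h1
    exact le_of_mul_le_mul_left h1 hQpos
  -- extrapolate the difference (degree ≤ K) from the odd nodes `1,…,2K+1`
  set Δ : Polynomial ℝ := Ps - PD with hΔ
  have hΔdeg : Δ.natDegree ≤ K := (natDegree_sub_le _ _).trans (max_le hPsdeg (hPDdeg.trans hDK))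
  have hΔ0 : |Δ.eval 0| ≤ 2 ^ (K + 1) * τ := by
    refine abs_eval_zero_le_two_pow_mul K Δ hΔdeg hτ0 fun j hj => ?_
    have h := hclose j (by omega)
    rw [hΔ, eval_sub]
    push_cast at h ⊢
    exact h
  -- the design value through `Ps`, priced via `PD` (exactness) and the closeness on the design levels
  have hval : ∑ U, ∑ M, levelWeight n (2 * c' + 1) C w U M * (X U * Y M).trace = ∑ c ∈ C, w c * Ps.eval (c : ℝ) := by
    rw [value_eq_level_sums]
    refine sum_congr rfl fun c hc => ?_
    obtain ⟨⟨mm, hmm⟩, -, hcT, hne⟩ := hC c hc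
    have hmmc : mm ≤ c' := by omega
    have hQ0 : ((Qset n (2 * c' + 1) c).card : ℝ) ≠ 0 := by exact_mod_cast (card_pos.2 hne).ne'
    rw [level_sum_eq_sum_Qset, hmm, hlaw mm hmmc]
    field_simp
  rw [hval]
  have hsplit : ∑ c ∈ C, w c * Ps.eval (c : ℝ) = ∑ c ∈ C, w c * PD.eval (c : ℝ) + ∑ c ∈ C, w c * Δ.eval (c : ℝ) := by
    rw [← sum_add_distrib]
    exact sum_congr rfl fun c _ => by rw [hΔ, eval_sub]; ring
  have hexD : ∑ c ∈ C, w c * PD.eval (c : ℝ) = -PD.eval 0 := hexact PD hPDdeg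
  have herr : ∑ c ∈ C, w c * Δ.eval (c : ℝ) ≤ Bv * τ := by
    calc ∑ c ∈ C, w c * Δ.eval (c : ℝ) ≤ ∑ c ∈ C, |w c| * τ := by
          refine sum_le_sum fun c hc => ?_
          obtain ⟨⟨mm, hmm⟩, -, hcT, -⟩ := hC c hc
          have h := hclose mm (by omega)
          have h' : |Δ.eval (c : ℝ)| ≤ τ := by
            rw [hΔ, eval_sub, hmm]; exact h
          calc w c * Δ.eval (c : ℝ) ≤ |w c * Δ.eval (c : ℝ)| := le_abs_self _
            _ = |w c| * |Δ.eval (c : ℝ)| := abs_mul _ _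
            _ ≤ |w c| * τ := mul_le_mul_of_nonneg_left h' (abs_nonneg _)
      _ = (∑ c ∈ C, |w c|) * τ := by rw [sum_mul]
      _ ≤ Bv * τ := mul_le_mul_of_nonneg_right hBv hτ0
  have hPD0 : -PD.eval 0 = -Ps.eval 0 + Δ.eval 0 := by rw [hΔ, eval_sub]; ring
  have hΔ0' : Δ.eval 0 ≤ 2 ^ (K + 1) * τ := (le_abs_self _).trans hΔ0
  rw [hsplit, hexD, hPD0]
  nlinarith [hPs0, herr, hΔ0']

end Summit.PneNP.PneNP.Theorems.ChebyshevTracialDesignTwoCutoffBound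

end
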